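import Summits.QuantumFields.BalabanUV.T4Continuum.Support.NE7CriticalOrbitUniqueGeneric
import Summits.QuantumFields.BalabanUV.T4Continuum.Support.NE7AdmissibleFibreLHC
import Summits.QuantumFields.BalabanUV.T4Continuum.Support.NE7OpenOfMinimisation
import Summits.QuantumFields.BalabanUV.T4Continuum.Support.MinimalActionExistence
import HarnessLib

/-!
# NE7MinimalOrbitDatumContinuity — THE MINIMAL ORBIT `U_k(V)` DEPENDS CONTINUOUSLY ON THE DATUM `V` ([Balaban1985Variational] p. 279: «we will prove also some
# theorems about minimal configurations U_k(V) as functions of V; for example we will prove that they are analytic functions of V» — the QUALITATIVE first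
# clause, for OUR constrained minimisers): for every `U(n)`, every `L ≥ 2`, `d = 4`, over the small data and at every level, the correspondence
# `V ↦ {minimisers of the level-k constrained problem over V}` is UPPER HEMICONTINUOUS in the product topology (Berge), and the minimal action is CONTINUOUS in
# the datum; with the uniqueness of the minimal orbit (✓ p810527) this is continuity of the orbit map `V ↦ [U_k(V)]`

Cell `pub-balaban`, rung (B)+1 sub-cell t4, lineage `b2b-balaban-t4-ne7-p1` (CRUX PROVER NE7 #1 = OWNER of BINDER row NE7), generation 113.  Memo
`t4/b2b-balaban-t4-ne7-p1-g113/ROAD-G113.md` §5.  Over gen 68's ✓ `NE7AdmissibleFibreLHC.admissible_lhc` (LOWER hemicontinuity of the admissible fibres at an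
interior configuration: the `(k+1)`-fold average is a submersion in the torus chart, hence an open map — row NE3-R2's `hasStrictFDerivAt_levelQ` ∕ `levelQ'_onto` +
Mathlib's `HasStrictFDerivAt.map_nhds_eq_of_surj`), row NE3's `MinimalActionCompact` ∕ `MinimalActionExistence` (product topology: `isCompact_sfClass`,
`continuous_levelAction`, `continuousOn_avgIter`, `isCompact_admissible`, `exists_isMinimiser_of_nonempty`), gen 68's `NE7OpenOfMinimisation` (§2 periodic
bookkeeping) and gen 109's ✓ p810221 `NE7HintUnconditionalGeneric.hint_small_data_generic` ((8)∃ INTERIOR — the lower hemicontinuity is used at the interior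
minimiser).
THE ARGUMENT (Berge's maximum theorem, filters, no sequences).  Level `k+1`, datum `V₀` in the small data, `U♯` an interior minimiser over `V₀` ((8)∃), `m₀` its
action, `𝒰` open containing every minimiser over `V₀`.  (2) GAP: on the compact set `admissible(V₀) ∖ 𝒰` the continuous action attains its minimum, which is `> m₀`
(a configuration of action `≤ m₀` there would be a minimiser outside `𝒰`): `levelAction ≥ m₀ + 2η` off `𝒰` on the fibre of `V₀`.  (3) CLOSED: the data carrying a
class configuration `U ∉ 𝒰` with `avgIter U = V` and `levelAction U ≤ m₀ + η` form the image of the compact set `sfClass ∩ 𝒰ᶜ ∩ {levelAction ≤ m₀ + η}` under the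
`(k+1)`-fold average (continuous on the class) — a closed set not containing `V₀` by (2); so EVENTUALLY as `V → V₀` no such `U` exists.  (4) LHC: by `admissible_lhc`
at `(V₀, U♯)` with the open neighbourhood `{levelAction < m₀ + η}` of `U♯`, EVENTUALLY every unitary `N`-periodic `V` carries an admissible `W` with `levelAction W <
m₀ + η`; a minimiser `U` over such `V` has `levelAction U ≤ levelAction W < m₀ + η`, hence `U ∈ 𝒰` by (3).  Level `0`: the fibre is the datum alone.  The minimal
action: upper bound from (4), lower bound = (1)–(4) with `𝒰 := {levelAction > m₀ − η}`; existence over nearby data from (4) (level `k+1`, compactness) ∕ the open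
window-good set (level `0`).
WHAT ([folklore]; 0 def, 0 sorry; `d = 4`, every `U(n)`, every `L ≥ 2`).  **`minimisers_upperHemicontinuous`**: `∃ ε₀ > 0, ∀ 0 < ε ≤ ε₀, ∀ N ≥ 1, ∃ δ_V > 0, ∀ V₀
(unitary, N-periodic, SmallField V₀ δ_V), ∀ k, ∀ 𝒰 open ⊇ {minimisers over V₀}: ∀ᶠ V in 𝓝 V₀, V unitary ∧ N-periodic → every minimiser of sfClass 4 L N ε at level k
over V lies in 𝒰`.  **`minAct_continuous`**: same thresholds, `∃ U♯` minimiser over `V₀` and `∀ η > 0, ∀ᶠ V in 𝓝 V₀, V unitary ∧ N-periodic → (a minimiser over V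
exists) ∧ every minimiser U over V has |levelAction U − levelAction U♯| < η`.
DICTIONARY WITH PRINT: qualitative continuity of `V ↦ U_k(V)` (modulo gauge, by ✓ p810527's orbit uniqueness: every open neighbourhood of the minimal ORBIT over
`V₀` eventually contains all minimisers over `V`); print's last section asserts ANALYTICITY with expansions — NOT claimed (needs the implicit-function continuation
on the Euler–Lagrange system, a separate line).
HONEST FRAMING (page 1): soft topology (compactness, Berge) over landed kernel theorems of this lineage and rows NE3∕NE3-R2; nothing of Bałaban's asserted as an
axiom and NOT his method; finite 4-torus, small data, thresholds existential (`δ_V(n, L, ε, N)`); NOT NE7 as a spine node (dagwriter∕referees' call), NOT NE3;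
spine 0∕9; NOT infinite volume, NOT mass gap, NOT BetaPertH, NOT Clay (continuum YM on T⁴ ⇐ BetaPertH ∧ nine spine estimates).
-/

set_option autoImplicit false

open scoped BigOperators Matrix Matrix.Norms.L2Operator Topology
open NormedSpace Finset Set Filter

namespace Summit.QuantumFields.BalabanUV.T4Continuum.NE7MinimalOrbitDatumContinuity

open Literature.MathematicalPhysics.QuantumFieldTheory.Balaban1983to89
open B7Prop1Explicit B7Prop2Explicit
open T4AveragingDeficitWall (IsUnitaryCfg IsSkewDir SmallField)
open T4AveragingDeficitWallBoundary (IsPeriodicCfg periodBox)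
open AveragingDeficitMultiLevelPrep (LevelSmall)
open MinimalActionLevels (perWin levelAction)
open MinimalActionSandwich (IsMinimiser admissible)
open MinimalActionRate (sfClass)
open MinimalActionCompact (isCompact_sfClass continuous_levelAction continuousOn_avgIter)
open MinimalActionExistence (isCompact_admissible exists_isMinimiser_of_nonempty)
open NE7HintUnconditionalGeneric (hint_small_data_generic)
open NE7EnergyClassPoincareGeneric (classPackage)
open NE7AllMinimisersSmallGeneric (eq_of_admissible_zero)
open NE7AdmissibleFibreLHC (admissible_lhc)
open NE7OpenOfMinimisation (smallField_of_window isOpen_goodSet)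

noncomputable section

variable {n : Type} [Fintype n] [DecidableEq n]

/-! ## §1 Thresholds: the (8)∃ radius together with the class smallness of rows NE3 ∕ NE3-R2 -/

/-- The common thresholds of this file: below `ε₀` the (8)∃ INTERIOR minimiser exists over the small data (✓ p810221), the level family `LevelSmall` holds, and
the two class-smallness lines of `MinimalActionCompact.continuousOn_avgIter` hold. [folklore] -/
theorem thresholds [Nonempty n] {L : ℕ} (hL : 2 ≤ L) :
    ∃ ε₀ : ℝ, 0 < ε₀ ∧ ∀ ε : ℝ, 0 < ε → ε ≤ ε₀ →
      16 * C0 4 * ε ≤ 3 ∧ 1024 * (((4 : ℕ) : ℝ) + 1) * (((4 : ℕ) : ℝ) + 4) * (L : ℝ) ^ 2 * ε ≤ 1 ∧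
      (∀ j : ℕ, LevelSmall 4 L j (ε / ((L : ℝ) ^ (j + 1)) ^ 2)) ∧
      ∀ (N : ℕ) [NeZero N], 1 ≤ N → ∃ δV : ℝ, 0 < δV ∧
        ∀ V ∈ {V : Site 4 → Fin 4 → (Matrix n n ℂ)ˣ | IsUnitaryCfg V ∧ IsPeriodicCfg V (N : ℤ) ∧ SmallField V δV},
        ∀ k : ℕ, ∃ U : Site 4 → Fin 4 → (Matrix n n ℂ)ˣ, IsMinimiser 4 (sfClass 4 L N ε) L N k V U ∧
          ∃ a : ℝ, 0 ≤ a ∧ a < ε / ((L : ℝ) ^ k) ^ 2 ∧ SmallField U a := by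
  obtain ⟨ε₁, hε₁, H1⟩ := hint_small_data_generic (n := n) hL
  obtain ⟨θ₀, CF, CE, hθ₀, -, -, -, h16, h1024, hlsP, -, -⟩ := classPackage (n := n) (d := 4) (by norm_num) hL
  refine ⟨min ε₁ θ₀, lt_min hε₁ hθ₀, fun ε hε hεle => ?_⟩
  have hεε₁ : ε ≤ ε₁ := hεle.trans (min_le_left _ _)
  have hεθ₀ : ε ≤ θ₀ := hεle.trans (min_le_right _ _)
  have hC0 : (0 : ℝ) ≤ 16 * C0 4 := by have := C0_pos 4; positivity
  have hD0 : (0 : ℝ) ≤ 1024 * (((4 : ℕ) : ℝ) + 1) * (((4 : ℕ) : ℝ) + 4) * (L : ℝ) ^ 2 := by positivity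
  refine ⟨(mul_le_mul_of_nonneg_left hεθ₀ hC0).trans h16, (mul_le_mul_of_nonneg_left hεθ₀ hD0).trans h1024, hlsP hε.le hεθ₀,
    fun N _ hN => H1 ε hε hεε₁ N hN⟩

/-! ## §2 Berge: the minimisers over nearby data lie in any open set containing the minimisers over `V₀` -/

/-- **UPPER HEMICONTINUITY OF THE MINIMISERS IN THE DATUM, EVERY `U(n)`, EVERY `L ≥ 2`, `d = 4`** (statement and argument in the file header): over the small data,
at every level `k`, for every open set `𝒰` containing all constrained minimisers of `sfClass 4 L N ε` over `V₀`, EVENTUALLY as the unitary `N`-periodic datum `V → V₀`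
(product topology) every constrained minimiser over `V` lies in `𝒰`. [folklore] -/
theorem minimisers_upperHemicontinuous [Nonempty n] {L : ℕ} (hL : 2 ≤ L) :
    ∃ ε₀ : ℝ, 0 < ε₀ ∧ ∀ ε : ℝ, 0 < ε → ε ≤ ε₀ → ∀ (N : ℕ) [NeZero N], 1 ≤ N →
      ∃ δV : ℝ, 0 < δV ∧
        ∀ V₀ ∈ {V : Site 4 → Fin 4 → (Matrix n n ℂ)ˣ | IsUnitaryCfg V ∧ IsPeriodicCfg V (N : ℤ) ∧ SmallField V δV},
        ∀ (k : ℕ) (𝒰 : Set (Site 4 → Fin 4 → (Matrix n n ℂ)ˣ)), IsOpen 𝒰 →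
          (∀ U : Site 4 → Fin 4 → (Matrix n n ℂ)ˣ, IsMinimiser 4 (sfClass 4 L N ε) L N k V₀ U → U ∈ 𝒰) →
          ∀ᶠ V in 𝓝 V₀, IsUnitaryCfg V → IsPeriodicCfg V (N : ℤ) →
            ∀ U : Site 4 → Fin 4 → (Matrix n n ℂ)ˣ, IsMinimiser 4 (sfClass 4 L N ε) L N k V U → U ∈ 𝒰 := by
  haveI : NeZero L := ⟨by omega⟩
  have hL1 : 1 ≤ L := by omega
  obtain ⟨ε₀, hε₀, H⟩ := thresholds (n := n) hL
  refine ⟨ε₀, hε₀, fun ε hε hεle N _ hN => ?_⟩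
  obtain ⟨hε1, hε2, hls, H1⟩ := H ε hε hεle
  obtain ⟨δ₁, hδ₁, hint₁⟩ := H1 N hN
  refine ⟨δ₁, hδ₁, fun V₀ hV₀ k 𝒰 h𝒰o h𝒰 => ?_⟩
  cases k with
  | zero =>
      -- level 0: the fibre of a datum is the datum alone
      obtain ⟨U₀, hU₀, -⟩ := hint₁ V₀ hV₀ 0
      have hV₀𝒰 : V₀ ∈ 𝒰 := by
        have h := h𝒰 U₀ hU₀
        rwa [eq_of_admissible_zero hU₀.mem] at h
      filter_upwards [h𝒰o.mem_nhds hV₀𝒰] with V hV _ _ U hU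
      rwa [eq_of_admissible_zero hU.mem]
  | succ k =>
      -- the interior minimiser over `V₀` and its action
      obtain ⟨Us, hUs, a, -, haε, hUsa⟩ := hint₁ V₀ hV₀ (k + 1)
      set m₀ : ℝ := levelAction 4 L N (k + 1) Us with hm₀
      -- (2) GAP off `𝒰` on the fibre of `V₀`
      have hgap : ∃ η : ℝ, 0 < η ∧ ∀ U ∈ admissible (sfClass 4 L N ε) L (k + 1) V₀, U ∉ 𝒰 → m₀ + 2 * η ≤ levelAction 4 L N (k + 1) U := by
        by_cases hne : (admissible (sfClass 4 L N ε) L (k + 1) V₀ ∩ 𝒰ᶜ).Nonempty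
        · have hK : IsCompact (admissible (sfClass 4 L N ε) L (k + 1) V₀ ∩ 𝒰ᶜ) :=
            (isCompact_admissible (d := 4) (n := n) hL hε.le hε1 hε2 N (k + 1) V₀).inter_right h𝒰o.isClosed_compl
          obtain ⟨U₁, ⟨hU₁adm, hU₁𝒰⟩, hU₁min⟩ := hK.exists_isMinOn hne (continuous_levelAction (d := 4) (n := n) L N (k + 1)).continuousOn
          have hlt : m₀ < levelAction 4 L N (k + 1) U₁ :=
            lt_of_not_ge fun hle : m₀ ≥ levelAction 4 L N (k + 1) U₁ =>
              hU₁𝒰 (h𝒰 U₁ ⟨hU₁adm, fun W hW => (show levelAction 4 L N (k + 1) U₁ ≤ m₀ from hle).trans (hUs.le W hW)⟩)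
          refine ⟨(levelAction 4 L N (k + 1) U₁ - m₀) / 2, by linarith, fun U hU hU𝒰 => ?_⟩
          have h : levelAction 4 L N (k + 1) U₁ ≤ levelAction 4 L N (k + 1) U := hU₁min ⟨hU, hU𝒰⟩
          linarith
        · exact ⟨1, one_pos, fun U hU hU𝒰 => absurd ⟨U, hU, hU𝒰⟩ hne⟩
      obtain ⟨η, hη, hgap'⟩ := hgap
      -- (3) CLOSED: the data carrying a near-minimal class configuration outside `𝒰`
      set C : Set (Site 4 → Fin 4 → (Matrix n n ℂ)ˣ) :=
        sfClass 4 L N ε (k + 1) ∩ (𝒰ᶜ ∩ {U | levelAction 4 L N (k + 1) U ≤ m₀ + η}) with hC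
      have hCc : IsCompact C := (isCompact_sfClass (d := 4) (n := n) L N ε (k + 1)).inter_right
        (h𝒰o.isClosed_compl.inter (isClosed_le (continuous_levelAction (d := 4) (n := n) L N (k + 1)) continuous_const))
      have havg : ContinuousOn (fun U : Site 4 → Fin 4 → (Matrix n n ℂ)ˣ => avgIter L U (k + 1)) C :=
        (continuousOn_avgIter (d := 4) (n := n) hL hε.le hε1 hε2 (k + 1) (k + 1) le_rfl).mono fun U hU => ⟨hU.1.1, hU.1.2.2⟩
      set B : Set (Site 4 → Fin 4 → (Matrix n n ℂ)ˣ) := (fun U : Site 4 → Fin 4 → (Matrix n n ℂ)ˣ => avgIter L U (k + 1)) '' C with hB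
      have hBcl : IsClosed B := (hCc.image_of_continuousOn havg).isClosed
      have hV₀B : V₀ ∉ B := by
        rintro ⟨U, hUC, hUV⟩
        have h := hgap' U ⟨hUC.1, hUV⟩ hUC.2.1
        have h2 : levelAction 4 L N (k + 1) U ≤ m₀ + η := hUC.2.2
        linarith
      have hstep3 : ∀ᶠ V in 𝓝 V₀, V ∉ B := hBcl.isOpen_compl.mem_nhds hV₀B
      -- (4) LHC: a competitor of action `< m₀ + η` over every nearby datum
      have h𝒲 : {U : Site 4 → Fin 4 → (Matrix n n ℂ)ˣ | levelAction 4 L N (k + 1) U < m₀ + η} ∈ 𝓝 Us :=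
        (isOpen_lt (continuous_levelAction (d := 4) (n := n) L N (k + 1)) continuous_const).mem_nhds
          (show levelAction 4 L N (k + 1) Us < m₀ + η by linarith)
      have hstep4 := admissible_lhc (d := 4) (n := n) hL1 hε.le (hls k) hUs.mem haε hUsa h𝒲
      filter_upwards [hstep3, hstep4] with V hVB hVW hVu hVP U hU
      obtain ⟨W, hW𝒲, hWadm⟩ := hVW hVu hVP
      by_contra hU𝒰
      have hle : levelAction 4 L N (k + 1) U ≤ m₀ + η := ((hU.le W hWadm).trans_lt hW𝒲).le
      exact hVB ⟨U, ⟨hU.mem.1, hU𝒰, hle⟩, hU.mem.2⟩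

/-! ## §3 The minimal action is continuous in the datum, and minimisers exist over nearby data -/

/-- **CONTINUITY OF THE MINIMAL ACTION IN THE DATUM, EVERY `U(n)`, EVERY `L ≥ 2`, `d = 4`**: over the small data, at every level `k`, there is a minimiser `U♯` over
`V₀`, and for every `η > 0`, EVENTUALLY as the unitary `N`-periodic datum `V → V₀`: a constrained minimiser over `V` exists, and every minimiser `U` over `V` has
`|levelAction U − levelAction U♯| < η`. [folklore] -/
theorem minAct_continuous [Nonempty n] {L : ℕ} (hL : 2 ≤ L) :
    ∃ ε₀ : ℝ, 0 < ε₀ ∧ ∀ ε : ℝ, 0 < ε → ε ≤ ε₀ → ∀ (N : ℕ) [NeZero N], 1 ≤ N →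
      ∃ δV : ℝ, 0 < δV ∧
        ∀ V₀ ∈ {V : Site 4 → Fin 4 → (Matrix n n ℂ)ˣ | IsUnitaryCfg V ∧ IsPeriodicCfg V (N : ℤ) ∧ SmallField V δV},
        ∀ k : ℕ, ∃ Us : Site 4 → Fin 4 → (Matrix n n ℂ)ˣ, IsMinimiser 4 (sfClass 4 L N ε) L N k V₀ Us ∧
          ∀ η : ℝ, 0 < η →
            ∀ᶠ V in 𝓝 V₀, IsUnitaryCfg V → IsPeriodicCfg V (N : ℤ) →
              (∃ U : Site 4 → Fin 4 → (Matrix n n ℂ)ˣ, IsMinimiser 4 (sfClass 4 L N ε) L N k V U) ∧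
              ∀ U : Site 4 → Fin 4 → (Matrix n n ℂ)ˣ, IsMinimiser 4 (sfClass 4 L N ε) L N k V U →
                |levelAction 4 L N k U - levelAction 4 L N k Us| < η := by
  haveI : NeZero L := ⟨by omega⟩
  have hL1 : 1 ≤ L := by omega
  have hL0 : (0 : ℝ) < L := by exact_mod_cast (show 0 < L by omega)
  obtain ⟨ε₀, hε₀, H⟩ := thresholds (n := n) hL
  obtain ⟨ε₂, hε₂, H2⟩ := minimisers_upperHemicontinuous (n := n) hL
  refine ⟨min ε₀ ε₂, lt_min hε₀ hε₂, fun ε hε hεle N _ hN => ?_⟩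
  obtain ⟨hε1, hε2, hls, H1⟩ := H ε hε (hεle.trans (min_le_left _ _))
  obtain ⟨δ₁, hδ₁, hint₁⟩ := H1 N hN
  obtain ⟨δ₂, hδ₂, husc⟩ := H2 ε hε (hεle.trans (min_le_right _ _)) N hN
  -- the data radius: both radii, and `< ε` strictly (level `0`: nearby periodic data stay in the class)
  refine ⟨min (min δ₁ δ₂) (ε / 2), lt_min (lt_min hδ₁ hδ₂) (by positivity), fun V₀ hV₀ k => ?_⟩
  obtain ⟨hV₀u, hV₀P, hV₀δ⟩ := hV₀
  have hV₀1 : V₀ ∈ {V : Site 4 → Fin 4 → (Matrix n n ℂ)ˣ | IsUnitaryCfg V ∧ IsPeriodicCfg V (N : ℤ) ∧ SmallField V δ₁} :=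
    ⟨hV₀u, hV₀P, MinimalActionRate.SmallField.mono hV₀δ ((min_le_left _ _).trans (min_le_left _ _))⟩
  have hV₀2 : V₀ ∈ {V : Site 4 → Fin 4 → (Matrix n n ℂ)ˣ | IsUnitaryCfg V ∧ IsPeriodicCfg V (N : ℤ) ∧ SmallField V δ₂} :=
    ⟨hV₀u, hV₀P, MinimalActionRate.SmallField.mono hV₀δ ((min_le_left _ _).trans (min_le_right _ _))⟩
  have hV₀ε : SmallField V₀ (ε / 2) := MinimalActionRate.SmallField.mono hV₀δ (min_le_right _ _)
  obtain ⟨Us, hUs, a, -, haε, hUsa⟩ := hint₁ V₀ hV₀1 k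
  refine ⟨Us, hUs, fun η hη => ?_⟩
  set m₀ : ℝ := levelAction 4 L N k Us with hm₀
  -- every minimiser over `V₀` has action `m₀`
  have hminact : ∀ U : Site 4 → Fin 4 → (Matrix n n ℂ)ˣ, IsMinimiser 4 (sfClass 4 L N ε) L N k V₀ U → levelAction 4 L N k U = m₀ :=
    fun U hU => le_antisymm (hU.le Us hUs.mem) (hUs.le U hU.mem)
  -- LOWER bound from §2 with `𝒰 := {levelAction > m₀ − η}`
  have hlow := husc V₀ hV₀2 k {U | m₀ - η < levelAction 4 L N k U}
    (isOpen_lt continuous_const (continuous_levelAction (d := 4) (n := n) L N k))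
    (fun U hU => by show m₀ - η < levelAction 4 L N k U; rw [hminact U hU]; linarith)
  cases k with
  | zero =>
      -- level 0: the fibre of a nearby periodic datum `V` is `{V}` as soon as `V` is in the class, which it eventually is (open window-good set)
      have hgood : V₀ ∈ {U : Site 4 → Fin 4 → (Matrix n n ℂ)ˣ | ∀ x ∈ periodBox (d := 4) N, ∀ κ κ' : Fin 4, κ ≠ κ' →
          ‖((hol U x (plaqWord κ κ') : (Matrix n n ℂ)ˣ) : Matrix n n ℂ) - 1‖ < ε} := by
        intro x _ κ κ' hκ
        exact (hV₀ε x κ κ' hκ).trans_lt (by linarith)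
      have hev : ∀ᶠ V in 𝓝 V₀, V ∈ {U : Site 4 → Fin 4 → (Matrix n n ℂ)ˣ | ∀ x ∈ periodBox (d := 4) N, ∀ κ κ' : Fin 4, κ ≠ κ' →
          ‖((hol U x (plaqWord κ κ') : (Matrix n n ℂ)ˣ) : Matrix n n ℂ) - 1‖ < ε} := (isOpen_goodSet (d := 4) (n := n) N ε).mem_nhds hgood
      -- continuity of the action at `V₀`
      have hact : ∀ᶠ V in 𝓝 V₀, |levelAction 4 L N 0 V - levelAction 4 L N 0 V₀| < η := by
        have hc := (continuous_levelAction (d := 4) (n := n) L N 0).continuousAt (x := V₀)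
        have := (Metric.tendsto_nhds.mp hc) η hη
        exact this.mono fun V hV => by rwa [Real.dist_eq] at hV
      have hUsV₀ : Us = V₀ := eq_of_admissible_zero hUs.mem
      filter_upwards [hev, hact] with V hVgood hVact hVu hVP
      have hVcl : V ∈ sfClass 4 L N ε 0 := by
        refine ⟨hVu, by simpa using hVP, ?_⟩
        have hS : SmallField V ε := smallField_of_window (d := 4) (P := N) hVP fun x hx κ κ' hκ => (hVgood x hx κ κ' hκ).le
        simpa using hS
      have hVadm : V ∈ admissible (sfClass 4 L N ε) L 0 V := ⟨hVcl, avgIter_zero L V⟩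
      have hVmin : IsMinimiser 4 (sfClass 4 L N ε) L N 0 V V :=
        ⟨hVadm, fun U' hU' => by rw [eq_of_admissible_zero hU']⟩
      refine ⟨⟨V, hVmin⟩, fun U hU => ?_⟩
      rw [eq_of_admissible_zero hU.mem, hm₀, hUsV₀]
      exact hVact
  | succ k =>
      -- UPPER bound and existence from the lower hemicontinuity at the interior minimiser `U♯`
      have h𝒲 : {U : Site 4 → Fin 4 → (Matrix n n ℂ)ˣ | levelAction 4 L N (k + 1) U < m₀ + η} ∈ 𝓝 Us :=
        (isOpen_lt (continuous_levelAction (d := 4) (n := n) L N (k + 1)) continuous_const).mem_nhds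
          (show levelAction 4 L N (k + 1) Us < m₀ + η by linarith)
      have hstep4 := admissible_lhc (d := 4) (n := n) hL1 hε.le (hls k) hUs.mem haε hUsa h𝒲
      filter_upwards [hlow, hstep4] with V hVlow hVW hVu hVP
      obtain ⟨W, hW𝒲, hWadm⟩ := hVW hVu hVP
      have hex : ∃ U : Site 4 → Fin 4 → (Matrix n n ℂ)ˣ, IsMinimiser 4 (sfClass 4 L N ε) L N (k + 1) V U :=
        exists_isMinimiser_of_nonempty (d := 4) (n := n) hL hε.le hε1 hε2 ⟨W, hWadm⟩
      refine ⟨hex, fun U hU => ?_⟩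
      have hup : levelAction 4 L N (k + 1) U < m₀ + η := (hU.le W hWadm).trans_lt hW𝒲
      have hdn : m₀ - η < levelAction 4 L N (k + 1) U := hVlow hVu hVP U hU
      rw [abs_sub_lt_iff]
      constructor <;> linarith

end

end Summit.QuantumFields.BalabanUV.T4Continuum.NE7MinimalOrbitDatumContinuity
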